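import Literature.Geometry.Lorentzian.OutermostHorizon
import Literature.Geometry.Lorentzian.MassCapacity
import HarnessLib

/-!
# The case of equality of the Riemannian Penrose inequality: the corrected statement and Bray's
# Theorem 19 (case of equality) and §13 step for exterior regions (family `gr`, statement
# **gr.S09**; namespace `Literature.Geometry.Lorentzian`)

This file does for the rigidity fact `riemannian_penrose_rigidity` of `MassInequalities.lean`
(the case of equality of Bray, J. Differential Geom. 59 (2001) 177–267 = arXiv:math/9911173,
same numbering, Thm. 1 (p. 185) and Thm. 19 (p. 240)) what `OutermostHorizon.lean` does for the
inequality `riemannian_penrose_inequality`: it records the **corrected statement** and vendors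
the printed results it rests on as **named facts** in the exterior-region encoding of
`ExteriorRegion.lean` (the case of equality of Thm. 19; and, one layer down, the step of §13 that
feeds the case of equality of Thm. 9, already vendored in `MassCapacity.lean`). The reductions —
and the case of equality with the outermost hypothesis in printed form, as a theorem conditional
on these facts — are proved in `PenroseRigidityProofs.lean`.

The source. Thm. 19 (p. 240; §13): *Let `(M³, g)` be a complete, smooth, asymptotically flat
`3`-manifold with boundary which has nonnegative scalar curvature and total mass `m`. Then if
the boundary is an outer-minimizing horizon (with one or more components) of total area `A`,
then `m ≥ √(A/16π)`, with equality if and only if `(M³, g)` is isometric to a Schwarzschild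
manifold outside their respective outermost horizons* (Thm. 1, p. 185, is the boundaryless
version; the Schwarzschild manifold of mass `m > 0` is `(ℝ³ ∖ {0}, (1 + m/2r)⁴ δ)`, (12), whose
horizon is the coordinate sphere `r = m/2`, §1–§2). Asymptotic flatness is Def. 21 (p. 238), the
total mass is the flux limit (225). Bray's proof of the case of equality (§13, the paragraph
following Thm. 18): by Thm. 18 the conformal flow of metrics `g_t = u_t⁴ g₀` (Thm. 2) exists for
asymptotically flat manifolds, with `A(t)` constant and `m(t)` nonincreasing (Thm. 3), and
`m(t) ≥ √(A(t)/16π)` for all `t ≥ 0` ((226)); equality at `t = 0` therefore gives equality for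
all `t`, so the right-hand derivative of `m(t)` at `t = 0` vanishes, and the derivative formula
of §7 (the display preceding Thm. 10, `d m/dt^±|_{t=0} = ℰ(Σ^±(0), g₀) - 2 m(0)`) yields
`ℰ(Σ⁺(0), g₀) = 2 m(0)` for the outermost minimal area enclosure `Σ⁺(0)` of the horizon `Σ₀`;
by the case of equality of the mass–capacity theorem, Thm. 9 (§6; vendored as
`Bray2001_capacity_rigidity` in `MassCapacity.lean`), `(M³, g)` is a Schwarzschild manifold
outside `Σ⁺(0)`, which is then the outermost horizon.

Contents:

* `riemannian_penrose_rigidity_smooth` — the **corrected statement** of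
  `riemannian_penrose_rigidity`: its hypotheses verbatim **plus smoothness of the unit normal
  `S.ν`** of the horizon as a map into `TX`, and its conclusion verbatim (the minimal repair, as
  `riemannian_penrose_inequality_connected_smooth` and `riemannian_penrose_inequality_smooth`);
  the original — deprecated in `MassInequalities.lean` (2026-08-15) in favour of this statement —
  implies it trivially, by supplying the extra hypothesis, so no bridge theorem is kept;
* `Bray2001_penrose_rigidity_exteriorRegion` — **named fact**: the case of equality of Thm. 19,
  combined (as `Bray2001_penrose_inequality_exteriorRegion`) with Huisken–Ilmanen's Lemma 4.1
  (ii) (the boundary of an exterior region minimises area in its homology class, so is an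
  outer-minimizing horizon), for an exterior region presented as an open `U ⊆ X` of the
  boundaryless data manifold with compact minimal topological boundary `∂U = range B.f`
  (`MinimalBoundary`) containing no other compact immersed minimal surface: if
  `√(|Σ₀|/16π) = m` for a nonempty compact surface `Σ₀` smoothly embedded into `∂U`, then `U`
  is isometric to the Schwarzschild exterior `({m/2 < ‖y‖}, (1 + m/2‖y‖)⁴ δ)`;
* `Bray2001_capacity_eq_of_penrose_eq` — **named fact**: the step of §13 preceding the appeal to
  Thm. 9, in the same exterior-region setting: equality `√(|Σ₀|/16π) = m` forces
  `ℰ(∂M', g) = 2m` for the capacity `ℰ` of Def. 17 (`horizonCapacity` of `MassCapacity.lean`),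
  `∂M'` being its own outermost minimal area enclosure `Σ⁺(0)`;
* `Bray2001_oneSided_of_penrose_eq` — **named fact**: the area bookkeeping of Thm. 19 in the
  open-set encoding: in the case of equality no component of `∂U` is doubled in `∂M'`, i.e. `U`
  lies on one side of its boundary (the clause of `IsOutsideOf` that makes `∂U` a surface of
  Bray's class `𝒮`, Def. 3);
* (in `PenroseRigidityProofs.lean`) the **theorems**
  `riemannian_penrose_rigidity_outermost_of_penrose_rigidity_exteriorRegion` — the case of
  equality at the level of `OutermostMOTS` with the outermost hypothesis in the **printed form**
  of Huisken–Ilmanen's condition (iii) / Bray's Def. 5 (every image of a compact immersed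
  minimal surface in `closure S.exterior` lies in `S`) in place of `IsMinimalSurfaceFree`, from
  `Bray2001_penrose_rigidity_exteriorRegion` alone (applied to `U := S.exterior`, which is then
  itself an exterior region with boundary `S`; Bray's remark preceding Thm. 19) — and
  `riemannian_penrose_rigidity_outermost_of_capacity_rigidity'`, the same from
  `Bray2001_capacity_eq_of_penrose_eq`, `Bray2001_oneSided_of_penrose_eq` and
  `Bray2001_capacity_rigidity` (the last paragraph of Bray's proof of the case of equality,
  machine-checked on top of the named facts); and the reductions of
  `riemannian_penrose_rigidity_smooth` to these. (Until the review of 2026-08-15 (D-0026) the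
  printed-outermost form was a further named fact `riemannian_penrose_rigidity_outermost` of
  this file, reduced here to the facts below through `exteriorRegion_structure`; being the case
  of equality itself in a second encoding rather than an intermediate result, it was retired in
  favour of those conditional theorems, and the two reductions through `exteriorRegion_structure`
  — refuted as stated, `PenroseRigidityProofs.lean`, last section — were dropped with it.)

The further decomposition of `Bray2001_capacity_eq_of_penrose_eq` along the printed steps
recalled above (Thm. 18 = Thms. 2–3 for asymptotically flat manifolds, (226), the derivative
formula of §7) requires the conformal flow itself and is the subject of further files; Thm. 9
and the capacity `ℰ` are in `MassCapacity.lean`.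

## The corrected statement

`riemannian_penrose_rigidity` (`MassInequalities.lean`; deprecated there, 2026-08-15) is
**mis-stated** in the way recorded in that file (module docstring, "Known exception and
deprecations", and the docstring heading its section *gr.S09*) and in `OutermostHorizon.lean` for
the two inequality facts: the hypothesis
structure `OutermostMOTS` (`TrappedSurface.lean`) imposes no regularity on the unit normal `S.ν`
(a bare `NormalField`, constrained pointwise by `isUnitNormal` and `pointsInto`). Along a
component of `S` on both of whose sides `S.exterior` lies, `pointsInto` holds for both signs,
`S.ν` may flip sign on a set meeting every arc, the coefficient derivatives inside
`normalDerivAlong`/`covariantDerivAlong` (`Geodesic.lean`: `deriv`, junk value `0`) vanish, and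
`S.isMOTS` (`H = 0`) can hold although that component is no minimal surface. For the rigidity
statement the defect is sharper than for the inequality: its conclusion — `S.exterior` is
isometric to the Schwarzschild exterior `{E/2 < ‖y‖}`, whose metric completion adds a single
round sphere — forces `S` to be connected with `S.exterior` on one side of it, so in a two-sided
junk configuration meeting the hypotheses the conclusion fails outright; and in no case does the
source, whose horizons are smooth minimal surfaces, speak about such `S`. (For a component along
which `S.exterior` is one-sided, `pointsInto` pins `S.ν` to the smooth outward normal and no junk
arises.)

The corrected statement `riemannian_penrose_rigidity_smooth` therefore **adds the smoothness of
`S.ν`** as a map into `TX` (exactly as `riemannian_penrose_inequality_smooth` does) and keeps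
every other hypothesis and the conclusion of `riemannian_penrose_rigidity` verbatim. It is
implied by the sources by the argument recorded for `riemannian_penrose_inequality_smooth` in
`OutermostHorizon.lean` ("The corrected statement"): with a smooth normal, `S` is an honest
compact minimal surface bounding `V = S.exterior`; the exterior component `U = V ∖ K(V)` of the
end (Lemma 4.1 (i)) is bounded by embedded minimal spheres in `closure V = V ∪ S`; spheres
inside the open `V` are excluded by `IsMinimalSurfaceFree`, spheres meeting a component of `S`
contain it (boundary maximum principle) and coincide with it (invariance of domain); so
`∂U ⊆ S`, `U = V`, `∂U = S`, and Thm. 19 applies to the metric completion `M'` of `U`: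
`E ≥ √(A/16π) ≥ √(|S|/16π) = E` with `A = |∂M'|` (doubled components counted twice), so
`A = |S|`, no component is doubled, and the case of equality makes `M'` — whose outermost
horizon is `∂M' = S`, there being no other compact minimal surface in `M'` — the Schwarzschild
manifold of mass `E` outside its horizon, i.e. `U ≅ {E/2 < ‖y‖}`. The two parenthetical steps
are supplied in `OutermostHorizonSmooth.lean` / `PenroseRigidityProofs.lean`, where this
reduction is machine-checked (`riemannian_penrose_rigidity_smooth_of_penrose_rigidity_exteriorRegion`,
granted `exteriorRegion_structure` — see the caveat there) and where the case of equality with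
the outermost hypothesis in printed form is the theorem
`riemannian_penrose_rigidity_outermost_of_penrose_rigidity_exteriorRegion`, conditional on
`Bray2001_penrose_rigidity_exteriorRegion` alone.

## Mathlib

As for `ExteriorRegion.lean`/`OutermostHorizon.lean`: Mathlib (at the pin) has no minimal
surfaces, no manifolds with boundary obtained as closures or metric completions of open regions,
no ADM mass, no Schwarzschild metric, no capacity; used are `TopologicalSpace.Opens`,
`frontier`/`closure`, `Diffeomorph`, `innerSL ℝ` (the Euclidean metric `δ` on `E3`),
`Asymptotics.IsBigO` along `Bornology.cobounded`, `Real.sqrt`, `ENNReal.toReal`, `𝓝[<]`, and the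
H21 Lorentz prelude (`OutermostMOTS` + `surfaceArea`/`exterior`, `MinimalBoundary`,
`IsMinimalSurfaceImage`, `IsExteriorRegion`, `IsMinimalSurfaceFree`, `AFEnd` +
`IsAsymptoticallyFlat`/`IsMetricAsymptoticallyFlat`/`scalarCurvatureCoeff`/`HasADMEnergy`/
`admEnergy`, `InitialDataSet` + `IsTimeSymmetric`/`IsComplete`/`metric`, `scalarCurvature`,
`totalArea`, `inducedRiemannianMetric`, `contMDiff_pullbackBilin`, `pullbackBilin`,
`curveThrough`, `exteriorRegion`, and `horizonCapacity` of `MassCapacity.lean`).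

## Design choices

* *Open-set encoding and hypotheses* exactly as in `Bray2001_penrose_inequality_exteriorRegion`
  (`OutermostHorizon.lean`, "Design choices"): the printed `(M³, g)` of Thm. 19 is the metric
  completion `M'` of the open connected region `U` with compact minimal boundary
  `B : MinimalBoundary D.h U` (smooth unit normal) and the one end `e` (`IsExteriorRegion e U`);
  Def. 21 as `IsMetricAsymptoticallyFlat e D 1` (`p = 1 > 1/2`) **and** `|R(h)| = O(r^{-q})`,
  `q > 3`; `m = e.admEnergy D` under the hypothesis that the flux limit (225) exists; `R(h) ≥ 0`
  on `closure U`; the exterior-region hypothesis "every image of a compact immersed minimal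
  surface in `closure U` lies in `∂U`", which makes `M'` an exterior region (so `∂M'` is
  outer-minimizing by Lemma 4.1 (ii), of total area `A = |∂M'| ≥ |∂U|`) **and** makes `∂M'` the
  outermost horizon of `M'` (a horizon of `M'` is a compact minimal surface in `closure U`,
  hence a union of components of `∂U`).
* *Faithfulness of the conclusion.* For a nonempty compact surface `Σ₀` smoothly embedded into
  `∂U` with `√(|Σ₀|/16π) = m` (`|Σ₀| = totalArea (f₀^* h)`, the form of
  `OutermostMOTS.surfaceArea`), Thm. 19 gives `16π m² ≥ A ≥ |∂U| ≥ |Σ₀| = 16π m²`, so equality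
  holds in Thm. 19 and `M'` is isometric to the Schwarzschild manifold outside its outermost
  horizon `∂M'`: the interior `U` is isometric to `({m/2 < ‖y‖}, (1 + m/2‖y‖)⁴ δ)`. The model is
  stated without `ModelData`, as in `riemannian_penrose_rigidity` and `Bray2001_capacity_rigidity`:
  a diffeomorphism `Φ : U ≅ exteriorRegion (m/2) ⊆ E3` with `Φ^* ((1 + m/(2‖y‖))⁴ δ) = h|_U`
  (`pullbackBilin` against `D.metric.val` on the open submanifold; the mass parameter is `m`
  since the total mass is an isometry invariant of the end — Thm. 1 as stated in §1: "the
  Schwarzschild metric of mass `m`"; the isometry is smooth by Myers–Steenrod). Only the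
  direction "equality ⇒ Schwarzschild" is vendored.
* *The tensor `k`* of `D` plays no role in the exterior-region fact; `k = 0` is kept among the
  hypotheses of the gr.S09 statements, as in the original.

## References

* H. L. Bray, *Proof of the Riemannian Penrose inequality using the positive mass theorem*,
  J. Differential Geom. 59 (2001) 177–267 (arXiv:math/9911173): §1–§2, (12), Defs. 3–6 and
  Thm. 1 (pp. 183–185); §3, Thms. 2–4; §6, Def. 17, Thm. 9; §7, Thm. 10 and the derivative
  formula preceding it; §13, Def. 21, (225), Thm. 18, (226), the case of equality, Thm. 19
  (pp. 238–240).
* G. Huisken, T. Ilmanen, *The inverse mean curvature flow and the Riemannian Penrose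
  inequality*, J. Differential Geom. 59 (2001) 353–437: §4, Lemma 4.1 (i)–(ii).
* H. Federer, *Geometric Measure Theory*, Springer 1969, §3.2.46.
-/

noncomputable section

open Bundle Set Manifold TopologicalSpace Filter MeasureTheory Asymptotics
open scoped ContDiff Topology ENNReal Manifold Real

namespace Literature.Geometry.Lorentzian

open PseudoRiemannianMetric

/-! ### gr.S09, rigidity: the corrected statements -/

/-- **gr.S09** (Riemannian Penrose inequality, rigidity; **corrected form** of
`riemannian_penrose_rigidity` of `MassInequalities.lean`, see the module docstring, section "The
corrected statement", for the discrepancy: the original imposes no regularity on the unit normal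
`S.ν`, so that its `H = 0` may be vacuous and its conclusion then fails). Named fact: the case of
equality of Bray, J. Differential Geom. 59 (2001), Thm. 19 (p. 240) and Thm. 1 (p. 185): *let
`(M³, g)` be a complete smooth asymptotically flat `3`-manifold (with boundary an
outer-minimizing horizon, for Thm. 19) with nonnegative scalar curvature, total mass `m` and
horizon of total area `A`; then `m = √(A/16π)` if and only if `(M³, g)` is isometric to a
Schwarzschild manifold outside their respective outermost horizons*, the Schwarzschild manifold
of mass `m > 0` being `(ℝ³ ∖ {0}, (1 + m/2r)⁴ δ)` with horizon the coordinate sphere `r = m/2`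
((12), p. 185), "asymptotically flat" being Def. 21 (p. 238: `g = δ + O₂(|x|^{-p})`, `p > 1/2`,
**and** `|R(g)| = O(|x|^{-q})`, `q > 3`) and the total mass the flux limit (225). Hypotheses —
those of `riemannian_penrose_rigidity` verbatim **plus smoothness of the unit normal `S.ν`** as
a map into `TX` (so that `S.isMOTS` is the honest minimal-surface equation `H = 0`; automatic
for one-sided exteriors): `k = 0`; `R(h) ≥ 0`; asymptotic flatness of order `1` on `e` and
Bray's curvature decay `scalarCurvatureCoeff e D = O(‖x‖^{-q})` for some `q > 3`; completeness;
existence of the ADM energy limit (`m = E = e.admEnergy D`); a *nonempty* outermost minimal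
surface `S` (possibly disconnected) whose exterior is the connected exterior region of the end
`e` (`IsExteriorRegion`) containing no closed minimal surface (`IsMinimalSurfaceFree`); and
equality `√(|S|/16π) = E`. Conclusion (only the direction "equality ⇒ Schwarzschild" is
vendored): a diffeomorphism `Φ` of `S.exterior` onto `exteriorRegion (E/2) = {E/2 < ‖y‖} ⊆ E3`
with `Φ^* ((1 + E/(2‖y‖))⁴ δ) = h` there (the mass parameter is `E` since the total mass is an
isometry invariant of the end; the isometry is smooth by Myers–Steenrod). The variant with the
outermost hypothesis in printed form is the theorem
`riemannian_penrose_rigidity_outermost_of_penrose_rigidity_exteriorRegion` of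
`PenroseRigidityProofs.lean`, conditional on `Bray2001_penrose_rigidity_exteriorRegion` below.
[cite: BrayRPI2001, Thm. 19 (p. 240) and Thm. 1 (p. 185) equality case with (12), Def. 21 and (225)]
[cite: HuiskenIlmanenIMCF2001, Lemma 4.1 (i)–(ii)] -/
def riemannian_penrose_rigidity_smooth : Prop :=
  ∀ (X : Type) [TopologicalSpace X] [ChartedSpace E3 X] [IsManifold (𝓡 3) ∞ X] [T2Space X]
    [SecondCountableTopology X] [ConnectedSpace X]
    (D : InitialDataSet (𝓡 3) X) [D.metric.HasLeviCivita] (e : AFEnd X)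
    (S : OutermostMOTS (𝓡 3) D.h 0),
    ContMDiff (𝓡 2) (𝓡 3).tangent ∞
      (fun y ↦ (TotalSpace.mk' E3 (S.f y) (S.ν y) : TangentBundle (𝓡 3) X)) →
    D.IsTimeSymmetric → (∀ x : X, 0 ≤ D.metric.scalarCurvature x) →
    e.IsAsymptoticallyFlat D 1 →
    (∃ q : ℝ, 3 < q ∧
      (fun x ↦ e.scalarCurvatureCoeff D x) =O[Bornology.cobounded E3] fun x ↦ ‖x‖ ^ (-q)) →
    D.IsComplete → (∃ m, e.HasADMEnergy D m) → Nonempty S.surf →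
    IsMinimalSurfaceFree D.h S.exterior → IsExteriorRegion e S.exterior →
    Real.sqrt (S.surfaceArea.toReal / (16 * π)) = e.admEnergy D →
    ∃ Φ : Diffeomorph (𝓡 3) (𝓡 3) S.exterior (exteriorRegion (e.admEnergy D / 2)) ∞,
      ∀ x : S.exterior, pullbackBilin (I := 𝓡 3) (I' := 𝓡 3) Φ
        (fun y ↦ (1 + e.admEnergy D / (2 * ‖(y : E3)‖)) ^ 4 •
          (innerSL ℝ (E := E3) : E3 →L[ℝ] E3 →L[ℝ] ℝ)) x = D.metric.val x.1

/-! ### Bray's Theorem 19, case of equality, for exterior regions -/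

/-- **Riemannian Penrose inequality for exterior regions, case of equality** (named fact).
Bray, J. Differential Geom. 59 (2001), Thm. 19 (p. 240): *let `(M³, g)` be a complete, smooth,
asymptotically flat `3`-manifold with boundary which has nonnegative scalar curvature and total
mass `m`; if the boundary is an outer-minimizing horizon (with one or more components) of total
area `A`, then `m ≥ √(A/16π)`, with equality if and only if `(M³, g)` is isometric to a
Schwarzschild manifold outside their respective outermost horizons* — the Schwarzschild
manifold of mass `m` being `(ℝ³ ∖ {0}, (1 + m/2r)⁴ δ)`, (12), with the single horizon `r = m/2`
(§2, after Thm. 1), asymptotic flatness as in Def. 21 (`g_ij = δ_ij + O(|x|^{-p})`,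
`|x||g_ij,k| + |x|²|g_ij,kl| = O(|x|^{-p})`, `|R(g)| = O(|x|^{-q})`, `p > 1/2`, `q > 3`) and `m`
the flux limit (225); proved in §13 (paragraph after Thm. 18) from Thm. 18, (226), the
derivative formula of §7 preceding Thm. 10 and the case of equality of Thm. 9 — combined, as in
`Bray2001_penrose_inequality_exteriorRegion`, with Huisken–Ilmanen, J. Differential Geom. 59
(2001), Lemma 4.1 (ii): *the boundary of a `3`-dimensional exterior region (connected,
asymptotically flat, compact minimal boundary, no other compact minimal surfaces even immersed)
minimizes area in its homology class*, so that it is an outer-minimizing horizon (Bray, p. 185: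
"outermost horizons are always strictly outer-minimizing"). Vendored, as that fact, for `M'` the
metric completion of an open connected region `U` of the complete boundaryless data manifold
`(X, h)` (`D.IsComplete`) with compact minimal topological boundary `∂U = range B.f`
(`B : MinimalBoundary D.h U`: a compact smoothly embedded surface with smooth unit normal
pointing into `U` and `H = 0`; a component of `∂U` with `U` on both sides gives two components
of `∂M'`) and exactly one end, the end `e` (`IsExteriorRegion e U`: `U` connected,
`e.far R' ⊆ U`, `closure U ∖ e.far R'` compact — the compact set `K` of Def. 21), on which
Def. 21 holds: `h - δ = O₂(r⁻¹)` in the chart of `e` (`IsMetricAsymptoticallyFlat e D 1`,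
`p = 1`) and `|R(h)| = O(r^{-q})` for some `q > 3` (`scalarCurvatureCoeff`), the ADM energy flux
limit existing (it is then `m = e.admEnergy D`, same normalisation as (225)); nonnegative scalar
curvature on `closure U`; and the exterior-region hypothesis: every image of a compact immersed
minimal surface of `X` (smooth unit normal) contained in `closure U` is contained in `∂U` — so
`M'` is an exterior region, `∂M'` is outer-minimizing of total area `A = |∂M'| ≥ |∂U|` (doubled
components counted twice), and `∂M'` is the outermost horizon of `M'` (a horizon of `M'`, Def. 4,
is a compact minimal surface in `closure U`, hence a union of components of `∂U`). Hypothesis of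
the case of equality: `√(|Σ₀|/16π) = m` for a *nonempty* compact surface `S₀` (connected or not)
smoothly embedded into `X` by `f₀` with `range f₀ ⊆ ∂U`, `|Σ₀| = totalArea (f₀^* h)` being the
Riemannian area of the image (Federer 1969, §3.2.46; the form of `OutermostMOTS.surfaceArea`),
at most `|∂U| ≤ A`; then `16π m² = |Σ₀| ≤ |∂U| ≤ A ≤ 16π m²` by Thm. 19, so equality holds in
Thm. 19 (and no component of `∂U` is doubled), and `M'` is isometric to the Schwarzschild
manifold of mass `m` outside its horizon. Conclusion (only this direction is vendored), in the
form of `riemannian_penrose_rigidity` and `Bray2001_capacity_rigidity`: a diffeomorphism `Φ` of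
`U` onto `exteriorRegion (m/2) = {m/2 < ‖y‖} ⊆ E3`, `m = e.admEnergy D`, with
`Φ^* ((1 + m/(2‖y‖))⁴ δ) = h` on `U` (`pullbackBilin` against `D.metric.val` on the open
submanifold; the mass parameter is `m` since the total mass is an isometry invariant of the
end, Thm. 1 as stated in §1, "the Schwarzschild metric of mass `m`"; the isometry is smooth by
Myers–Steenrod). The tensor `k` of `D` plays no role.
[cite: BrayRPI2001, Thm. 19 (p. 240) equality case with (12), Def. 21, (225), and §13 (proof of the case of equality)]
[cite: HuiskenIlmanenIMCF2001, §4, Lemma 4.1 (ii) and its proof] -/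
def Bray2001_penrose_rigidity_exteriorRegion : Prop :=
  ∀ (X : Type) [TopologicalSpace X] [ChartedSpace E3 X] [IsManifold (𝓡 3) ∞ X] [T2Space X]
    [SecondCountableTopology X] [ConnectedSpace X]
    (D : InitialDataSet (𝓡 3) X) [D.metric.HasLeviCivita] (e : AFEnd X) (U : Opens X)
    (B : MinimalBoundary D.h (U : Set X)),
    D.IsComplete → IsExteriorRegion e U → e.IsMetricAsymptoticallyFlat D 1 →
    (∃ q : ℝ, 3 < q ∧
      (fun x ↦ e.scalarCurvatureCoeff D x) =O[Bornology.cobounded E3] fun x ↦ ‖x‖ ^ (-q)) →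
    (∃ m, e.HasADMEnergy D m) →
    (∀ x ∈ closure (U : Set X), 0 ≤ D.metric.scalarCurvature x) →
    (∀ N, IsMinimalSurfaceImage D.h N → N ⊆ closure (U : Set X) → N ⊆ range B.f) →
    ∀ (S₀ : Type) [TopologicalSpace S₀] [ChartedSpace (EuclideanSpace ℝ (Fin 2)) S₀]
      [IsManifold (𝓡 2) ∞ S₀] [CompactSpace S₀] [T2Space S₀]
      [MeasurableSpace S₀] [BorelSpace S₀]
      (f₀ : S₀ → X) (hpb₀ : contMDiff_pullbackBilin (𝓡 3) X (𝓡 2) S₀ ∞)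
      (hf₀ : (ofRiemannian D.h).IsSpacelikeImmersion (𝓡 2) f₀),
      Manifold.IsSmoothEmbedding (𝓡 2) (𝓡 3) ∞ f₀ → range f₀ ⊆ range B.f → Nonempty S₀ →
      Real.sqrt ((totalArea ((ofRiemannian D.h).inducedRiemannianMetric f₀ hpb₀ hf₀)).toReal /
        (16 * π)) = e.admEnergy D →
      ∃ Φ : Diffeomorph (𝓡 3) (𝓡 3) U (exteriorRegion (e.admEnergy D / 2)) ∞,
        ∀ x : U, pullbackBilin (I := 𝓡 3) (I' := 𝓡 3) Φ
          (fun y ↦ (1 + e.admEnergy D / (2 * ‖(y : E3)‖)) ^ 4 •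
            (innerSL ℝ (E := E3) : E3 →L[ℝ] E3 →L[ℝ] ℝ)) x = D.metric.val x.1

/-! ### The case of equality through the capacity of the horizon (Bray, §13 and Thm. 9) -/

/-- **Equality in the Penrose inequality forces equality in the mass–capacity inequality**
(named fact: the step of Bray's proof of the case of equality that precedes the appeal to
Thm. 9). Bray, J. Differential Geom. 59 (2001), §13, proof of the case of equality (the
paragraph following Thm. 18): *if we have equality in the Riemannian Penrose inequality, then
applying the conformal flow of metrics to this initial metric must also give equality in
inequality (226) [`m(t) ≥ √(A(t)/16π)`] for all `t ≥ 0`; hence, the right hand derivative of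
`m(t)` at `t = 0` equals zero, so by [the derivative formula of §7 preceding Thm. 10,
`d m/dt^±|_{t=0} = ℰ(Σ^±(0), g₀) - 2 m(0)`], `ℰ(Σ⁺(0), g₀) = 2 m(0)`; and `Σ⁺(0)` is the
outermost minimal area enclosure of `Σ₀` in `(M³, g)`* — resting on Thm. 18 (Thm. 2, existence
of the conformal flow `g_t = u_t⁴ g₀` with `Σ(t)` the outermost minimal area enclosure of the
horizon `Σ₀` in `g_t`, and Thm. 3, `A(t)` constant and `m(t)` nonincreasing, hold for
asymptotically flat manifolds), on (226), and on §4, Thm. 7 (`Σ(t) = Σ⁺(t)`) with Thm. 2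
(`Σ(t)` is a smooth horizon in `(M³, g_t)` for all `t ≥ 0`); `ℰ(Σ, g)` is the capacity of
Def. 17 (`inf_φ (1/2π) ∫ |∇φ|² dV` over the `φ → 1` at infinity vanishing on and inside `Σ`),
vendored as `horizonCapacity` in `MassCapacity.lean`. Stated in the exterior-region encoding,
under the hypotheses of `Bray2001_penrose_rigidity_exteriorRegion` verbatim (the setting of
Thm. 19: `M'` the metric completion of the open connected one-ended region `U` of the complete
data manifold `(X, h)` with compact minimal boundary `∂U = range B.f`, `B : MinimalBoundary D.h U`,
and no other compact immersed minimal surface in `closure U`; Def. 21 decay on the end `e` with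
`|R(h)| = O(r^{-q})`, `q > 3`; `m = e.admEnergy D` the flux limit (225), assumed to exist;
`R(h) ≥ 0` on `closure U`; and `√(|Σ₀|/16π) = m` for a nonempty compact surface `Σ₀` smoothly
embedded into `∂U`, `|Σ₀| = totalArea (f₀^* h)`), for the horizon `Σ₀ := ∂M'` of `M'`, which is
outer-minimizing by Huisken–Ilmanen, J. Differential Geom. 59 (2001), Lemma 4.1 (ii), so that
`16π m² = |Σ₀| ≤ |∂U| ≤ A = |∂M'| ≤ 16π m²` (Thm. 19) places `M'` in the case of equality; its
outermost minimal area enclosure `Σ⁺(0) = Σ(0)`, a horizon of `(M', g)` enclosing `∂M'`, is a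
compact minimal surface in `closure U`, hence lies in `∂U` and equals `∂M'`. Conclusion:
`ℰ(∂M', g) = 2m`, i.e. `(horizonCapacity D.h e U).toReal / 2 = e.admEnergy D` (the infimum over
the test functions `IsCapacityTestFn e U` — continuous on `X`, smooth on `U`, zero off `U`,
tending to `1` in `e` — is Bray's `ℰ` for the outside `U`, see the module docstring of
`MassCapacity.lean`). Instance hypotheses `[LocallyCompactSpace X] [MeasurableSpace X]
[BorelSpace X]` as in `MassCapacity.lean` (needed to form the capacity). The tensor `k` of `D`
plays no role.
[cite: BrayRPI2001, §13, proof of the case of equality (after Thm. 18), with Thm. 18, (226), §7 (derivative formula before Thm. 10), §4 Thm. 7, Def. 17 and Thm. 19]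
[cite: HuiskenIlmanenIMCF2001, §4, Lemma 4.1 (ii)] -/
def Bray2001_capacity_eq_of_penrose_eq : Prop :=
  ∀ (X : Type) [TopologicalSpace X] [ChartedSpace E3 X] [IsManifold (𝓡 3) ∞ X] [T2Space X]
    [SecondCountableTopology X] [LocallyCompactSpace X] [ConnectedSpace X]
    [MeasurableSpace X] [BorelSpace X]
    (D : InitialDataSet (𝓡 3) X) [D.metric.HasLeviCivita] (e : AFEnd X) (U : Opens X)
    (B : MinimalBoundary D.h (U : Set X)),
    D.IsComplete → IsExteriorRegion e U → e.IsMetricAsymptoticallyFlat D 1 →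
    (∃ q : ℝ, 3 < q ∧
      (fun x ↦ e.scalarCurvatureCoeff D x) =O[Bornology.cobounded E3] fun x ↦ ‖x‖ ^ (-q)) →
    (∃ m, e.HasADMEnergy D m) →
    (∀ x ∈ closure (U : Set X), 0 ≤ D.metric.scalarCurvature x) →
    (∀ N, IsMinimalSurfaceImage D.h N → N ⊆ closure (U : Set X) → N ⊆ range B.f) →
    ∀ (S₀ : Type) [TopologicalSpace S₀] [ChartedSpace (EuclideanSpace ℝ (Fin 2)) S₀]
      [IsManifold (𝓡 2) ∞ S₀] [CompactSpace S₀] [T2Space S₀]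
      [MeasurableSpace S₀] [BorelSpace S₀]
      (f₀ : S₀ → X) (hpb₀ : contMDiff_pullbackBilin (𝓡 3) X (𝓡 2) S₀ ∞)
      (hf₀ : (ofRiemannian D.h).IsSpacelikeImmersion (𝓡 2) f₀),
      Manifold.IsSmoothEmbedding (𝓡 2) (𝓡 3) ∞ f₀ → range f₀ ⊆ range B.f → Nonempty S₀ →
      Real.sqrt ((totalArea ((ofRiemannian D.h).inducedRiemannianMetric f₀ hpb₀ hf₀)).toReal /
        (16 * π)) = e.admEnergy D →
      (horizonCapacity D.h e U).toReal / 2 = e.admEnergy D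

/-- **In the case of equality the exterior region lies on one side of its boundary** (named
fact: the bookkeeping of boundary areas in Thm. 19 for the open-set encoding). Bray,
J. Differential Geom. 59 (2001), Thm. 19 (p. 240), the inequality `m ≥ √(A/16π)` for the metric
completion `M'` of an exterior region `U` (hypotheses of `Bray2001_penrose_rigidity_exteriorRegion`
verbatim), whose boundary `∂M'` is an outer-minimizing horizon by Huisken–Ilmanen,
J. Differential Geom. 59 (2001), Lemma 4.1 (ii), of total area `A = |∂M'|` in which a component
of `∂U` on both of whose sides `U` lies is counted twice (it is doubled by the metric completion,
as in Lemma 4.1): if `√(|Σ₀|/16π) = m` for a nonempty compact surface `Σ₀` smoothly embedded into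
`∂U`, then `16π m² = |Σ₀| ≤ |∂U| ≤ A ≤ 16π m²`, so `A = |∂U|` and no component of `∂U` is
doubled: `U` lies on exactly one side of each component of the embedded compact surface
`∂U = range B.f`, the side into which the unit normal `B.ν` points (`MinimalBoundary.pointsInto`).
Conclusion, in the form of the third clause of `IsOutsideOf` (`MassCapacity.lean`, Bray's class
`𝒮` of Def. 3: the outside of `Σ ∈ 𝒮` is a manifold with boundary `Σ`): for every `y`, the
chart-straight curve through `B.f y` with velocity `B.ν y` — which crosses `∂U` transversally at
`t = 0` — lies outside `closure U` for small `t < 0`.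
[cite: BrayRPI2001, Thm. 19 (p. 240) with Def. 3]
[cite: HuiskenIlmanenIMCF2001, §4, Lemma 4.1 (ii) and its proof] -/
def Bray2001_oneSided_of_penrose_eq : Prop :=
  ∀ (X : Type) [TopologicalSpace X] [ChartedSpace E3 X] [IsManifold (𝓡 3) ∞ X] [T2Space X]
    [SecondCountableTopology X] [ConnectedSpace X]
    (D : InitialDataSet (𝓡 3) X) [D.metric.HasLeviCivita] (e : AFEnd X) (U : Opens X)
    (B : MinimalBoundary D.h (U : Set X)),
    D.IsComplete → IsExteriorRegion e U → e.IsMetricAsymptoticallyFlat D 1 →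
    (∃ q : ℝ, 3 < q ∧
      (fun x ↦ e.scalarCurvatureCoeff D x) =O[Bornology.cobounded E3] fun x ↦ ‖x‖ ^ (-q)) →
    (∃ m, e.HasADMEnergy D m) →
    (∀ x ∈ closure (U : Set X), 0 ≤ D.metric.scalarCurvature x) →
    (∀ N, IsMinimalSurfaceImage D.h N → N ⊆ closure (U : Set X) → N ⊆ range B.f) →
    ∀ (S₀ : Type) [TopologicalSpace S₀] [ChartedSpace (EuclideanSpace ℝ (Fin 2)) S₀]
      [IsManifold (𝓡 2) ∞ S₀] [CompactSpace S₀] [T2Space S₀]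
      [MeasurableSpace S₀] [BorelSpace S₀]
      (f₀ : S₀ → X) (hpb₀ : contMDiff_pullbackBilin (𝓡 3) X (𝓡 2) S₀ ∞)
      (hf₀ : (ofRiemannian D.h).IsSpacelikeImmersion (𝓡 2) f₀),
      Manifold.IsSmoothEmbedding (𝓡 2) (𝓡 3) ∞ f₀ → range f₀ ⊆ range B.f → Nonempty S₀ →
      Real.sqrt ((totalArea ((ofRiemannian D.h).inducedRiemannianMetric f₀ hpb₀ hf₀)).toReal /
        (16 * π)) = e.admEnergy D →
      ∀ y, ∀ᶠ t in 𝓝[<] (0 : ℝ), curveThrough (𝓡 3) (B.f y) (B.ν y) t ∉ closure (U : Set X)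

end Literature.Geometry.Lorentzian

end
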